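import Summits.BirchSwinnertonDyer.BirchSwinnertonDyer.Theorems.PrintCFramBottomClassIndexLawFiveLeParitySplitPrimitivityBinders
import HarnessLib

/-!
# Crux `PrintCFram.BottomClassIndexLawFiveLe` (stmt-BirchSwinnertonDyer-20372), line `eisenstein-resource-bdp-line` (registry v19), stub B1
# `stub_bsdp_of_classFactor`: THE KOLYVAGIN READING OF B1 WITH BOTH NEW HYPOTHESES RESTRICTED TO B1's OWN LOCUS (the Eisenstein-IRREGULAR
# members) — B1 ⟸ B1-sha ∧ B1-prim|_{B1} ∧ C♭|_{B1}, and B1 ⟹ B1-prim|_{B1}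
# (cell `bsd-print-cfram`, width seat `bsd-line-cfram-p1-w3` g10; THEOREMS ONLY, `--supports` 20372; BSD is not proved by any of this)

HONEST FRAMING. THEOREMS ONLY (0 defs / 0 facts / 0 sorry); nothing about BSD is proved unconditionally; no stub is closed; no summit
statement is proved by this seat; the crux C2 stays OPEN and is NOT claimed false. Sequel of `…ParitySplitPrimitivityBinders` (same seat): there
B1-prim and the twist supply C♭_Ш are CHARACTER-FREE and quantify over every rank-one class member with `Ш(W/ℚ)[p] = 0`; on the REGULAR locus
(unit class factor) that content is already registry v19's Stub C + Kriz–Li (the (KL) branch of the composition proves `BSD_p` there). Here both are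
restricted to B1's own binders — an odd datum `(f, ψ, ω)` with the trace congruence and a NON-unit class factor `‖B_{1,ψ⁻¹}‖_p ≤ p⁻¹` — so that
the supply hypothesis is EXACTLY «C♭ on B1's locus» (w3 g9 notes §2(c)):

* **B1-prim|_{B1}** := «∀ class member `W` (CM, globally minimal, `CMRamified W p`, `p ≥ 5`, `r_an(W) = 1`), ∀ odd datum `(f, ψ, ω)` with `hss` and
  `‖B_{1,ψ⁻¹}‖_p ≤ p⁻¹`, if `Ш(W/ℚ)[p] = 0` then ∀ admissible Heegner datum `(N = N_W, K, Dt, H, ι, P)` (`d_K` odd `< −4`, `L(W^{(d_K)},1) ≠ 0`),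
  ∀ globally minimal model `Wd` of the twist with `Ш(Wd/ℚ)[p] = 0`: `padicValNat p [W(K):ℤP] = padicValNat p c`»;
* **C♭|_{B1}** := «same prefix ⟹ ∃ imaginary quadratic `K` Heegner for `N_W`, `d_K` odd `< −4`, `L(W^{(d_K)},1) ≠ 0`, and SOME globally minimal
  model `Wd` of the twist with `Ш(Wd/ℚ)[p] = 0`»;
* **B1-sha** (LEAD g11, character-free) as before.

* §1 `stubB1_of_sha_of_heegnerIndexOffLocus_of_twistSupplyOffLocus` — **B1 VERBATIM ⟸ B1-sha ∧ B1-prim|_{B1} ∧ C♭|_{B1}**, granted only the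
  `ToricPublishedInputs` conjuncts Gross–Zagier I.(6.3), Kolyvagin, GZK, modularity, Gross–Zagier I.(7.3), `exists_isHeegnerPoint` and Burungale–Flach
  Cor. 2 — MAZUR–WILES-FREE, KRIZ–LI-FREE, Cassels–Tate-free.
* §2 `heegnerIndexOffLocus_of_stubB1` — **B1 ⟹ B1-prim|_{B1}** (same facts): the primitivity half is NECESSARY.

So, modulo the supply C♭|_{B1} and LEAD g11's `B1 ⟹ B1-sha` (w6 g3's (α′)), **B1 ⟺ B1-sha ∧ B1-prim|_{B1}** — assembled in the END STATE file
`…EisensteinEndStateV19Primitivity` (Theses cone). ROUTE-INDEPENDENT here (no `Theses` import). CONDITIONAL on the displayed named facts.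
References: Gross–Zagier 1986 I.(6.3), V.§2; Kolyvagin 1990 Thm. A; Burungale–Flach 2024 Cor. 2; Kriz–Li 2019 Thm. 1.20, (29); crux workfiles
`Lines/eisenstein-resource-bdp-line-lead-g11.md` §5, `…-w3g9-notes.md` §2(c).
-/

set_option autoImplicit false
-- `…BirchSwinnertonDyer.BirchSwinnertonDyer.Theorems…` is the problem's mandated namespace (D-0017).
set_option linter.dupNamespace false

noncomputable section

open scoped Classical

namespace Summit.BirchSwinnertonDyer.BirchSwinnertonDyer.Theorems.PrintCFram.ParitySplit

open WeierstrassCurve NumberField IsDedekindDomain DirichletCharacter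
  Literature.NumberTheory.EllipticCurves
  Literature.NumberTheory.EllipticCurves.ModularForms
  Literature.NumberTheory.EllipticCurves.Rank1Residual
  Literature.NumberTheory.EllipticCurves.Rank1Residual.Typed
  Literature.NumberTheory.EllipticCurves.KrizLi2019
  Summit.BirchSwinnertonDyer.Rank1Residual
  Summit.BirchSwinnertonDyer.BirchSwinnertonDyer.Theorems
  Summit.BirchSwinnertonDyer.BirchSwinnertonDyer.Theorems.SchneiderFree
  Summit.BirchSwinnertonDyer.BirchSwinnertonDyer.Theorems.PrintCFram

/-! ## §1 B1 ⟸ B1-sha ∧ B1-prim|_{B1} ∧ C♭|_{B1} -/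

/-- **REGISTRY v19's B1 `stub_bsdp_of_classFactor`, VERBATIM, ⟸ B1-sha ∧ B1-prim|_{B1} ∧ C♭|_{B1}** — the Kolyvagin reading with the primitivity
statement (`hPrim`) and the twist supply (`hSup`) both carrying B1's own binders (odd datum `(f, ψ, ω)`, trace congruence, NON-unit class factor
`‖B_{1,ψ⁻¹}‖_p ≤ p⁻¹`) and the branch condition `Ш(W/ℚ)[p] = 0`. Granted Gross–Zagier I.(6.3) (`hGZ`), Kolyvagin (`hKo`), GZK (`hGZK`), modularity
(`hmod`), Gross–Zagier I.(7.3) (`hGZ73`), the Heegner-point supply (`hHP`) and Burungale–Flach Cor. 2 (`hBF`). Proof: on `Ш(W/ℚ)[p] ≠ 0`, B1-sha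
(`exists_sha_of_not_noPTorsion`); on `Ш(W/ℚ)[p] = 0`, `hSup` hands an admissible Heegner `K` with `L(W^{(d_K)},1) ≠ 0` and a `p`-regular twist,
`exists_isHeegnerPoint` the datum `(Dt, H, ι, P)` at level `N_W`, `bsdp_twistModel_of_bsdTriple` the `BSD_p` of the supplied minimal twist model `Wd`, `hPrim` the index identity, `bsdp_iff_heegnerIndex_cmRamified` (`.mpr`) the descent. MAZUR–WILES-FREE,
KRIZ–LI-FREE. CONDITIONAL; closes no stub; BSD is not proved by any of this.
[cite: GrossZagier1986, I.§4, Thm. I.(6.3) and V.§2 (pp. 310–312)] [cite: Kolyvagin1990, Thm. A] [cite: BurungaleFlach2024, Thm. 1.1 and Cor. 2]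
[cite: KrizLi2019, Thm. 1.20 (pp. 7–8), (29) (pp. 49–50)] [cite: SilvermanAEC2009, VIII.8 Cor. 8.3 and X.§4] -/
theorem stubB1_of_sha_of_heegnerIndexOffLocus_of_twistSupplyOffLocus
    (hGZ : ∀ (N : ℕ) [NeZero N] (W : WeierstrassCurve ℚ) (K : Type) [Field K] [NumberField K], gross_zagier N W K)
    (hKo : ∀ (N : ℕ) [NeZero N] (W : WeierstrassCurve ℚ) (K : Type) [Field K] [NumberField K], kolyvagin N W K)
    (hGZK : rank_eq_analyticRank_of_analyticRank_le_one) (hmod : hasEntireLFunction_rat) (hGZ73 : GrossZagier1986_thm_I_7_3)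
    (hHP : ∀ (W : WeierstrassCurve ℚ) (K : Type) [Field K] [NumberField K], exists_isHeegnerPoint W K)
    (hBF : bsdTriple_of_hasCM_of_L_one_ne_zero)
    (hSha :
    ∀ (W : WeierstrassCurve ℚ) [W.IsElliptic] [W.IsGloballyMinimal] (p : ℕ) [Fact p.Prime],
      W.HasCM → CMRamified W p → 5 ≤ p → W.analyticRank = 1 →
      (∃ s ∈ W.sha, s ≠ 0 ∧ p • s = 0) → BSDp W p)
    (hPrim :
    ∀ (W : WeierstrassCurve ℚ) [W.IsElliptic] [W.IsGloballyMinimal] (p : ℕ) [Fact p.Prime],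
      W.HasCM → CMRamified W p → 5 ≤ p → W.analyticRank = 1 →
      ∀ (f : ℕ) [NeZero f] (ψ : DirichletCharacter ℚ_[p] f) (ω : DirichletCharacter ℚ_[p] p),
        ψ.Odd → IsTeichmullerCharacter ω →
        (∀ ℓ : ℕ, ℓ.Prime → ¬ (ℓ ∣ p * W.conductorNorm ℤ) →
          ‖((W.LFunction ℓ : ℤ) : ℚ_[p]) - (ψ (ℓ : ZMod f) + ψ⁻¹ (ℓ : ZMod f) * ω (ℓ : ZMod p))‖ < 1) →
        ‖bernoulliOnePrim ψ⁻¹‖ ≤ (p : ℝ)⁻¹ →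
        (∀ s ∈ W.sha, p • s = 0 → s = 0) →
        ∀ (N : ℕ) [NeZero N] (K : Type) [Field K] [NumberField K]
          (Dt : ModularParametrizationData W N) (H : HeegnerDatum N (NumberField.discr K)) (ι : K →+* ℂ)
          (P : (W.baseChange K).toAffine.Point) (Wd : WeierstrassCurve ℚ) [Wd.IsElliptic] [Wd.IsGloballyMinimal],
          W.conductorNorm ℤ = N → IsImaginaryQuadratic K → SatisfiesHeegnerHypothesis N K →
          Odd (NumberField.discr K) → NumberField.discr K < -4 →
          (W.quadraticTwist (NumberField.discr K : ℚ)).entireLFunction 1 ≠ 0 →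
          WeierstrassCurve.Affine.Point.map ι.toRatAlgHom P = heegnerPointComplex Dt H →
          (∃ C : VariableChange ℚ, C • W.quadraticTwist (NumberField.discr K : ℚ) = Wd) →
          (∀ s ∈ Wd.sha, p • s = 0 → s = 0) →
          padicValNat p (AddSubgroup.zmultiples P).index = padicValNat p Dt.c.natAbs)
    (hSup :
    ∀ (W : WeierstrassCurve ℚ) [W.IsElliptic] [W.IsGloballyMinimal] (p : ℕ) [Fact p.Prime],
      W.HasCM → CMRamified W p → 5 ≤ p → W.analyticRank = 1 →
      ∀ (f : ℕ) [NeZero f] (ψ : DirichletCharacter ℚ_[p] f) (ω : DirichletCharacter ℚ_[p] p),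
        ψ.Odd → IsTeichmullerCharacter ω →
        (∀ ℓ : ℕ, ℓ.Prime → ¬ (ℓ ∣ p * W.conductorNorm ℤ) →
          ‖((W.LFunction ℓ : ℤ) : ℚ_[p]) - (ψ (ℓ : ZMod f) + ψ⁻¹ (ℓ : ZMod f) * ω (ℓ : ZMod p))‖ < 1) →
        ‖bernoulliOnePrim ψ⁻¹‖ ≤ (p : ℝ)⁻¹ →
        (∀ s ∈ W.sha, p • s = 0 → s = 0) →
        ∃ (K : Type) (_ : Field K) (_ : NumberField K),
          IsImaginaryQuadratic K ∧ SatisfiesHeegnerHypothesis (W.conductorNorm ℤ) K ∧ Odd (NumberField.discr K) ∧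
          NumberField.discr K < -4 ∧ (W.quadraticTwist (NumberField.discr K : ℚ)).entireLFunction 1 ≠ 0 ∧
          ∃ (Wd : WeierstrassCurve ℚ) (_ : Wd.IsElliptic) (_ : Wd.IsGloballyMinimal),
            (∃ C : VariableChange ℚ, C • W.quadraticTwist (NumberField.discr K : ℚ) = Wd) ∧
            ∀ s ∈ Wd.sha, p • s = 0 → s = 0) :
    ∀ (W : WeierstrassCurve ℚ) [W.IsElliptic] [W.IsGloballyMinimal] (p : ℕ) [Fact p.Prime],
      W.HasCM → CMRamified W p → 5 ≤ p → W.analyticRank = 1 →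
      ∀ (f : ℕ) [NeZero f] (ψ : DirichletCharacter ℚ_[p] f) (ω : DirichletCharacter ℚ_[p] p),
        ψ.Odd → IsTeichmullerCharacter ω →
        (∀ ℓ : ℕ, ℓ.Prime → ¬ (ℓ ∣ p * W.conductorNorm ℤ) →
          ‖((W.LFunction ℓ : ℤ) : ℚ_[p]) - (ψ (ℓ : ZMod f) + ψ⁻¹ (ℓ : ZMod f) * ω (ℓ : ZMod p))‖ < 1) →
        ‖bernoulliOnePrim ψ⁻¹‖ ≤ (p : ℝ)⁻¹ →
        BSDp W p := by
  intro W _ _ p _ hCM hram h5 hr f _ ψ ω hodd hω hss hcls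
  by_cases h0 : ∀ s ∈ W.sha, p • s = 0 → s = 0
  · -- small-Selmer branch on B1's locus
    obtain ⟨K, _, _, hK, hHN, hoddK, hd4, hLt, Wd, _, _, hC, h0d⟩ := hSup W p hCM hram h5 hr f ψ ω hodd hω hss hcls h0
    haveI hN0 : NeZero (W.conductorNorm ℤ) := ⟨W.conductorNorm_pos_holds.ne'⟩
    obtain ⟨P, Dt, H, ι, hP⟩ := hHP W K hK hHN
    have hWd : BSDp Wd p := bsdp_twistModel_of_bsdTriple hBF hmod W hCM hram K Wd hC hLt
    have hidx := hPrim W p hCM hram h5 hr f ψ ω hodd hω hss hcls h0 (W.conductorNorm ℤ) K Dt H ι P Wd rfl hK hHN hoddK hd4 hLt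
      hP hC h0d
    exact (bsdp_iff_heegnerIndex_cmRamified hGZ hKo hGZK hmod hGZ73 W hCM hram h5 hr (W.conductorNorm ℤ) K Dt H ι P Wd rfl hK hHN
      hoddK hd4 hLt hP hC (noPTorsion_of_forall_mem_sha W p h0) (noPTorsion_of_forall_mem_sha Wd p h0d) hWd).mpr hidx
  · -- `Ш(W)[p] ≠ 0`: B1-sha
    exact hSha W p hCM hram h5 hr (exists_sha_of_not_noPTorsion W p h0)

/-! ## §2 B1 ⟹ B1-prim|_{B1} -/

/-- **B1 ⟹ B1-prim|_{B1}** (granted Gross–Zagier I.(6.3), Kolyvagin, GZK, modularity, Gross–Zagier I.(7.3), Burungale–Flach Cor. 2): on B1's locus,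
`BSD_p(W)` (from B1, `hB1` = registry v19's text verbatim) forces the Heegner index identity on the branch `Ш(W/ℚ)[p] = 0` at every admissible Heegner
datum with a `p`-regular minimal twist model (`heegnerIndex_of_bsdp_cmRamified`). So the primitivity half of the Kolyvagin reading is NECESSARY. CONDITIONAL;
closes no stub; BSD is not proved by any of this. [cite: GrossZagier1986, Thm. I.(6.3) and V.§2 (pp. 310–312)] [cite: BurungaleFlach2024, Thm. 1.1 and Cor. 2]
[cite: Miller2011LMS, §1 and Def. 1.1] -/
theorem heegnerIndexOffLocus_of_stubB1
    (hGZ : ∀ (N : ℕ) [NeZero N] (W : WeierstrassCurve ℚ) (K : Type) [Field K] [NumberField K], gross_zagier N W K)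
    (hKo : ∀ (N : ℕ) [NeZero N] (W : WeierstrassCurve ℚ) (K : Type) [Field K] [NumberField K], kolyvagin N W K)
    (hGZK : rank_eq_analyticRank_of_analyticRank_le_one) (hmod : hasEntireLFunction_rat) (hGZ73 : GrossZagier1986_thm_I_7_3)
    (hBF : bsdTriple_of_hasCM_of_L_one_ne_zero)
    (hB1 :
    ∀ (W : WeierstrassCurve ℚ) [W.IsElliptic] [W.IsGloballyMinimal] (p : ℕ) [Fact p.Prime],
      W.HasCM → CMRamified W p → 5 ≤ p → W.analyticRank = 1 →
      ∀ (f : ℕ) [NeZero f] (ψ : DirichletCharacter ℚ_[p] f) (ω : DirichletCharacter ℚ_[p] p),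
        ψ.Odd → IsTeichmullerCharacter ω →
        (∀ ℓ : ℕ, ℓ.Prime → ¬ (ℓ ∣ p * W.conductorNorm ℤ) →
          ‖((W.LFunction ℓ : ℤ) : ℚ_[p]) - (ψ (ℓ : ZMod f) + ψ⁻¹ (ℓ : ZMod f) * ω (ℓ : ZMod p))‖ < 1) →
        ‖bernoulliOnePrim ψ⁻¹‖ ≤ (p : ℝ)⁻¹ →
        BSDp W p) :
    ∀ (W : WeierstrassCurve ℚ) [W.IsElliptic] [W.IsGloballyMinimal] (p : ℕ) [Fact p.Prime],
      W.HasCM → CMRamified W p → 5 ≤ p → W.analyticRank = 1 →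
      ∀ (f : ℕ) [NeZero f] (ψ : DirichletCharacter ℚ_[p] f) (ω : DirichletCharacter ℚ_[p] p),
        ψ.Odd → IsTeichmullerCharacter ω →
        (∀ ℓ : ℕ, ℓ.Prime → ¬ (ℓ ∣ p * W.conductorNorm ℤ) →
          ‖((W.LFunction ℓ : ℤ) : ℚ_[p]) - (ψ (ℓ : ZMod f) + ψ⁻¹ (ℓ : ZMod f) * ω (ℓ : ZMod p))‖ < 1) →
        ‖bernoulliOnePrim ψ⁻¹‖ ≤ (p : ℝ)⁻¹ →
        (∀ s ∈ W.sha, p • s = 0 → s = 0) →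
        ∀ (N : ℕ) [NeZero N] (K : Type) [Field K] [NumberField K]
          (Dt : ModularParametrizationData W N) (H : HeegnerDatum N (NumberField.discr K)) (ι : K →+* ℂ)
          (P : (W.baseChange K).toAffine.Point) (Wd : WeierstrassCurve ℚ) [Wd.IsElliptic] [Wd.IsGloballyMinimal],
          W.conductorNorm ℤ = N → IsImaginaryQuadratic K → SatisfiesHeegnerHypothesis N K →
          Odd (NumberField.discr K) → NumberField.discr K < -4 →
          (W.quadraticTwist (NumberField.discr K : ℚ)).entireLFunction 1 ≠ 0 →
          WeierstrassCurve.Affine.Point.map ι.toRatAlgHom P = heegnerPointComplex Dt H →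
          (∃ C : VariableChange ℚ, C • W.quadraticTwist (NumberField.discr K : ℚ) = Wd) →
          (∀ s ∈ Wd.sha, p • s = 0 → s = 0) →
          padicValNat p (AddSubgroup.zmultiples P).index = padicValNat p Dt.c.natAbs := by
  intro W _ _ p _ hCM hram h5 hr f _ ψ ω hodd hω hss hcls h0 N _ K _ _ Dt H ι P Wd _ _ hN hK hHN hoddK hd4 hLt hP hC h0d
  exact heegnerIndex_of_bsdp_cmRamified hGZ hKo hGZK hmod hGZ73 hBF W hCM hram h5 hr (hB1 W p hCM hram h5 hr f ψ ω hodd hω hss hcls) h0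
    N K Dt H ι P Wd hN hK hHN hoddK hd4 hLt hP hC h0d

end Summit.BirchSwinnertonDyer.BirchSwinnertonDyer.Theorems.PrintCFram.ParitySplit

end
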